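import Literature.NumberTheory.EllipticCurves.PadicPointsFiltrationProofs
import HarnessLib

/-!
# Homomorphisms of `p`-adic points with a linear term: the image of the formal filtration

Topic `NumberTheory/EllipticCurves`; a proofs-only file (theorems only: no definitions, no named
facts), part of the finite-place half of step (V) ("local volumes") of the proof of Milne,
*Arithmetic Duality Theorems*, Thm. I.7.3 (isogeny invariance of the Birch–Swinnerton-Dyer
quotient; the named fact `WeierstrassCurve.bsdRHS_eq_of_isIsogenous`).  There (p. 98), for an
isogeny `f : A → B` over `K_v` and `ω_A = f^*ω_B`, Milne computes
`z(f(K_v)) = #ker f(K_v)/#coker f(K_v) = μ_v(A, f^*ω_B)/μ_v(B, ω_B)` with Haar measures.  For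
elliptic curves over `ℚ_p` the same number is reached without measures through the filtration
`E(ℚ_p) ⊇ E⁽ᴺ⁾(ℚ_p) ≅ ℤ_p` (Silverman, *AEC*, IV.3.2, IV.6.4, VII.6.3; in the tree
`WeierstrassCurve.formalFiltration`, `WeierstrassCurve.padicLimitLog` and the files
`PadicPointsFiltration{,Proofs}`): an isogeny acts on the formal groups by a power series
`k T + O(T²)` whose linear coefficient `k` is its multiplier on invariant differentials
(`f^*ω' = k ω`, *AEC* IV.4.2–4.3), hence maps `E⁽ᴺ⁾` isomorphically onto `E'⁽ᴺ⁺ᵛ⁽ᵏ⁾⁾` for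
`N ≫ 0`, which gives `z(f(ℚ_p)) = |k|_p · [E(ℚ_p):E⁽ᴺ⁾]/[E'(ℚ_p):E'⁽ᴺ⁾]` (this is the shape in
which the local factor is used by Schaefer, *Class groups and Selmer groups*, J. Number Theory 56
(1996), Lemma 3.8, and by Dokchitser–Dokchitser 2010, §4.2).

This file proves the **abstract `p`-adic step** of that computation, for an ARBITRARY additive
homomorphism `f : E(ℚ_p) → E'(ℚ_p)` between the points of two `p`-integral elliptic Weierstrass
equations which, near `O`, is linear to first order in the parameters `z = -x/y`:
`‖z'(f P) - k·z(P)‖ ≤ C·‖z(P)‖²` on some `E⁽ᴺ⁰⁾` (hypothesis `hf` below; for the map on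
`ℚ_p`-points of an isogeny this estimate, with `k` the multiplier on invariant differentials, is
the subject of a sibling file).  With `L` the limit logarithm `L(P) = lim z(pʲP)/pʲ` of
`PadicPointsFiltration`:

* `WeierstrassCurve.norm_formalParameter_map_eq_of_linearTerm`: `‖z'(f P)‖ = ‖k‖·‖z(P)‖` on `E⁽ᴺ⁾`,
  `N ≫ 0`;
* `WeierstrassCurve.padicLimitLog_map_eq_mul_of_linearTerm`: **`L'(f P) = k · L(P)`** on `E⁽ᴺ⁾`
  (`f(pʲP) = pʲ f(P)` and `‖z(pʲP)‖ = p⁻ʲ‖z(P)‖`, so the quadratic error dies in the limit);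
* `WeierstrassCurve.map_formalFiltration_eq_of_linearTerm`: **`f(E⁽ᴺ⁾) = E'⁽ᴹ⁾`** whenever
  `p⁻ᴹ = ‖k‖·p⁻ᴺ`, `M ≥ 2`, `N ≫ 0` (`⊆` by the norm identity; `⊇` because `L : E⁽ᴺ⁾ → pᴺℤ_p`
  is onto and `L'` is injective on `E'⁽ᴹ⁾`, *AEC* VII.6.3 as proved in
  `PadicPointsFiltrationProofs`);
* `WeierstrassCurve.ker_inf_formalFiltration_eq_bot_of_linearTerm`: `ker f ∩ E⁽ᴺ⁾ = 0`;
* `WeierstrassCurve.exists_map_formalFiltration_eq_of_linearTerm`: the packaged form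
  "for all `N ≥ N₁` there is `M ≥ 2` with `p⁻ᴹ = ‖k‖ p⁻ᴺ`, `f(E⁽ᴺ⁾) = E'⁽ᴹ⁾` and
  `ker f ∩ E⁽ᴺ⁾ = 0`".

Combined with the count `#ker f · [E':E'⁽ᴹ⁾] = #coker f · [E:E⁽ᴺ⁾]`
(`Literature.NumberTheory.EllipticCurves.card_ker_inf_mul_relIndex_eq`, file
`IsogenyRealPeriodProofs`) and the index formula `[E(ℚ_p):E⁽ᴺ⁾] = c_p · #Ẽ_ns(𝔽_p) · pᴺ⁻¹`
this is Milne's `z(f(ℚ_p)) = μ_p(E, f^*ω')/μ_p(E', ω')`.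

## References

* J. S. Milne, *Arithmetic Duality Theorems*, 2nd ed. (2006), Ch. I §7, proof of Thm. 7.3,
  p. 98 (the local factors `z(f(K_v))`). [MilneADT2006]
* J. H. Silverman, *The Arithmetic of Elliptic Curves*, 2nd ed., GTM 106 (2009), IV.2.1, IV.3.2,
  IV.4.2–4.3, IV.6.4, VII.2.2, VII.6.3. [SilvermanAEC2009]
* E. F. Schaefer, *Class groups and Selmer groups*, J. Number Theory 56 (1996) 79–114, Lemma 3.8.

## Design

Theorems only (D-0026).  The hypothesis is kept abstract (any additive `f`, any `k ≠ 0`, any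
real `C`); the thresholds are explicit inequalities (`C·p⁻ᴺ < ‖k‖`, `‖k‖·p⁻ᴺ < p⁻¹`) rather
than an unspecified `N ≫ 0`, and the target level `M` is specified by `p⁻ᴹ = ‖k‖·p⁻ᴺ`
(so `M = N + v_p(k)`), which avoids integer arithmetic in the statements; the existential
packaging at the end produces such `N`, `M` from `‖k‖ = p^{-v_p(k)}`.
-/

noncomputable section

open scoped Classical
open Filter Literature.NumberTheory.EllipticCurves
open scoped Topology

namespace WeierstrassCurve

variable {p : ℕ} [Fact p.Prime] {W W' : WeierstrassCurve ℚ_[p]} [hW : W.IsIntegral ℤ_[p]]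
  [hW' : W'.IsIntegral ℤ_[p]] [W.IsElliptic] [W'.IsElliptic]
  (f : W.toAffine.Point →+ W'.toAffine.Point) {k : ℚ_[p]} {C : ℝ} {N₀ N : ℕ}

omit hW' [W'.IsElliptic] in
/-- **Norm of the parameter of the image.** If `‖z'(f P) - k z(P)‖ ≤ C ‖z(P)‖²` on `E⁽ᴺ⁰⁾` and
`C p⁻ᴺ < ‖k‖`, then `‖z'(f P)‖ = ‖k‖ · ‖z(P)‖` for `P ∈ E⁽ᴺ⁾`, `N ≥ N₀` (the error is smaller
than the main term; ultrametric inequality). [Silverman AEC IV.3.2, IV.4.2 (a homomorphism of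
formal groups is `kT + O(T²)`)] [folklore] -/
theorem norm_formalParameter_map_eq_of_linearTerm
    (hf : ∀ P ∈ W.formalFiltration N₀, W'.IsInReductionKernel (f P) ∧
      ‖W'.formalParameter (f P) - k * W.formalParameter P‖ ≤ C * ‖W.formalParameter P‖ ^ 2)
    (hk0 : k ≠ 0) (hN₀ : N₀ ≤ N) (hC : C * ((p : ℝ)⁻¹) ^ N < ‖k‖) {P : W.toAffine.Point}
    (hP : P ∈ W.formalFiltration N) :
    ‖W'.formalParameter (f P)‖ = ‖k‖ * ‖W.formalParameter P‖ := by
  obtain ⟨-, hest⟩ := hf P (W.formalFiltration_antitone hN₀ hP)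
  by_cases hz : W.formalParameter P = 0
  · have hP0 : P = 0 := (W.formalParameter_eq_zero_iff hP.1).mp hz
    subst hP0
    rw [map_zero, W'.formalParameter_zero, W.formalParameter_zero, norm_zero, mul_zero]
  have hzpos : 0 < ‖W.formalParameter P‖ := norm_pos_iff.mpr hz
  have hlt : ‖W'.formalParameter (f P) - k * W.formalParameter P‖ < ‖k * W.formalParameter P‖ := by
    rw [norm_mul]
    refine hest.trans_lt ?_
    rcases le_or_gt C 0 with hC0 | hC0
    · exact (mul_nonpos_of_nonpos_of_nonneg hC0 (sq_nonneg _)).trans_lt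
        (mul_pos (norm_pos_iff.mpr hk0) hzpos)
    · calc C * ‖W.formalParameter P‖ ^ 2
          = (C * ‖W.formalParameter P‖) * ‖W.formalParameter P‖ := by ring
        _ ≤ (C * ((p : ℝ)⁻¹) ^ N) * ‖W.formalParameter P‖ :=
            mul_le_mul_of_nonneg_right (mul_le_mul_of_nonneg_left hP.2 hC0.le) hzpos.le
        _ < ‖k‖ * ‖W.formalParameter P‖ := mul_lt_mul_of_pos_right hC hzpos
  have h := Padic.add_eq_max_of_ne hlt.ne
  rw [sub_add_cancel, max_eq_right hlt.le, norm_mul] at h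
  exact h

omit hW' [W'.IsElliptic] in
/-- Under the same hypotheses and `‖k‖ p⁻ᴺ < p⁻¹`: `f P ∈ E'₁(ℚ_p)` with `‖z'(f P)‖ < p⁻¹`
(the range in which the limit logarithm of `E'` is controlled). [folklore] -/
theorem norm_formalParameter_map_lt_of_linearTerm
    (hf : ∀ P ∈ W.formalFiltration N₀, W'.IsInReductionKernel (f P) ∧
      ‖W'.formalParameter (f P) - k * W.formalParameter P‖ ≤ C * ‖W.formalParameter P‖ ^ 2)
    (hk0 : k ≠ 0) (hN₀ : N₀ ≤ N) (hC : C * ((p : ℝ)⁻¹) ^ N < ‖k‖)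
    (hk : ‖k‖ * ((p : ℝ)⁻¹) ^ N < (p : ℝ)⁻¹) {P : W.toAffine.Point} (hP : P ∈ W.formalFiltration N) :
    W'.IsInReductionKernel (f P) ∧ ‖W'.formalParameter (f P)‖ < (p : ℝ)⁻¹ := by
  refine ⟨(hf P (W.formalFiltration_antitone hN₀ hP)).1, ?_⟩
  rw [norm_formalParameter_map_eq_of_linearTerm f hf hk0 hN₀ hC hP]
  exact (mul_le_mul_of_nonneg_left hP.2 (norm_nonneg k)).trans_lt hk

/-- **The limit logarithm intertwines `f` with multiplication by `k`:** `L'(f P) = k · L(P)` for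
`P ∈ E⁽ᴺ⁾`, `N ≥ max(N₀, 2)`, `C p⁻ᴺ < ‖k‖`, `‖k‖ p⁻ᴺ < p⁻¹`.  Proof: `pʲ • f P = f (pʲ • P)`,
`‖z(pʲP)‖ = p⁻ʲ ‖z(P)‖`, so `z'(pʲ f P)/pʲ - k z(pʲ P)/pʲ` has norm `≤ C ‖z(P)‖² p⁻ʲ → 0`, while
the two sequences tend to `L'(f P)` and `k L(P)`.  This is the pointwise shadow of
`log_{E'} ∘ F = k · log_E` for a homomorphism `F(T) = kT + ⋯` of formal groups (Silverman AEC
IV.4.3, IV.6.4; Milne ADT I.7, p. 98: `μ_v(U, f^*ω) = μ_v(fU, ω)`). [cite: SilvermanAEC2009, IV.6.4] -/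
theorem padicLimitLog_map_eq_mul_of_linearTerm
    (hf : ∀ P ∈ W.formalFiltration N₀, W'.IsInReductionKernel (f P) ∧
      ‖W'.formalParameter (f P) - k * W.formalParameter P‖ ≤ C * ‖W.formalParameter P‖ ^ 2)
    (hk0 : k ≠ 0) (hN₀ : N₀ ≤ N) (hN2 : 2 ≤ N) (hC : C * ((p : ℝ)⁻¹) ^ N < ‖k‖)
    (hk : ‖k‖ * ((p : ℝ)⁻¹) ^ N < (p : ℝ)⁻¹) {P : W.toAffine.Point} (hP : P ∈ W.formalFiltration N) :
    W'.padicLimitLog (f P) = k * W.padicLimitLog P := by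
  have hpR : (0 : ℝ) < p := by exact_mod_cast (Fact.out : p.Prime).pos
  have hp1 : (p : ℝ)⁻¹ < 1 := inv_lt_one_of_one_lt₀ (by exact_mod_cast (Fact.out : p.Prime).one_lt)
  have hrP : ‖W.formalParameter P‖ < (p : ℝ)⁻¹ := norm_formalParameter_lt_inv_of_mem hN2 hP
  obtain ⟨hfP, hrfP⟩ := norm_formalParameter_map_lt_of_linearTerm f hf hk0 hN₀ hC hk hP
  have htP := W.tendsto_approx_padicLimitLog hP.1 hrP
  have htfP := W'.tendsto_approx_padicLimitLog hfP hrfP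
  -- the error term
  have herr : ∀ j : ℕ, ‖W'.formalParameter ((p ^ j : ℕ) • f P) / (p : ℚ_[p]) ^ j -
      k * (W.formalParameter ((p ^ j : ℕ) • P) / (p : ℚ_[p]) ^ j)‖ ≤
      C * ‖W.formalParameter P‖ ^ 2 * ((p : ℝ)⁻¹) ^ j := by
    intro j
    have hPj : (p ^ j : ℕ) • P ∈ W.formalFiltration N := AddSubgroup.nsmul_mem _ hP _
    obtain ⟨-, hest⟩ := hf _ (W.formalFiltration_antitone hN₀ hPj)
    rw [W.norm_formalParameter_p_pow_nsmul hP.1 hrP j] at hest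
    have hsplit : W'.formalParameter (f ((p ^ j : ℕ) • P)) / (p : ℚ_[p]) ^ j -
        k * (W.formalParameter ((p ^ j : ℕ) • P) / (p : ℚ_[p]) ^ j) =
        (W'.formalParameter (f ((p ^ j : ℕ) • P)) - k * W.formalParameter ((p ^ j : ℕ) • P)) /
          (p : ℚ_[p]) ^ j := by ring
    rw [← map_nsmul, hsplit, norm_div, norm_pow, Padic.norm_p,
      div_le_iff₀ (pow_pos (inv_pos.mpr hpR) _)]
    refine hest.trans (le_of_eq ?_)
    ring
  have herr0 : Tendsto (fun j : ℕ => W'.formalParameter ((p ^ j : ℕ) • f P) / (p : ℚ_[p]) ^ j -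
      k * (W.formalParameter ((p ^ j : ℕ) • P) / (p : ℚ_[p]) ^ j)) atTop (𝓝 0) := by
    rw [tendsto_zero_iff_norm_tendsto_zero]
    have hg : Tendsto (fun j : ℕ => C * ‖W.formalParameter P‖ ^ 2 * ((p : ℝ)⁻¹) ^ j) atTop (𝓝 0) := by
      have := (tendsto_pow_atTop_nhds_zero_of_lt_one (inv_nonneg.mpr (Nat.cast_nonneg p)) hp1).const_mul
        (C * ‖W.formalParameter P‖ ^ 2)
      rwa [mul_zero] at this
    exact squeeze_zero (fun j => norm_nonneg _) herr hg
  have hsum := herr0.add (htP.const_mul k)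
  rw [zero_add] at hsum
  have hsum' : Tendsto (fun j : ℕ => W'.formalParameter ((p ^ j : ℕ) • f P) / (p : ℚ_[p]) ^ j)
      atTop (𝓝 (k * W.padicLimitLog P)) :=
    hsum.congr fun j => by ring
  exact tendsto_nhds_unique htfP hsum'

/-- **`f(E⁽ᴺ⁾) ⊆ E'⁽ᴹ⁾`** when `p⁻ᴹ = ‖k‖ p⁻ᴺ` (i.e. `M = N + v_p(k)`), `N ≥ N₀`, `C p⁻ᴺ < ‖k‖`.
[Silverman AEC IV.3.2; Milne ADT I.7, p. 98] [folklore] -/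
theorem map_mem_formalFiltration_of_linearTerm
    (hf : ∀ P ∈ W.formalFiltration N₀, W'.IsInReductionKernel (f P) ∧
      ‖W'.formalParameter (f P) - k * W.formalParameter P‖ ≤ C * ‖W.formalParameter P‖ ^ 2)
    (hk0 : k ≠ 0) (hN₀ : N₀ ≤ N) (hC : C * ((p : ℝ)⁻¹) ^ N < ‖k‖) {M : ℕ}
    (hM : ((p : ℝ)⁻¹) ^ M = ‖k‖ * ((p : ℝ)⁻¹) ^ N) {P : W.toAffine.Point}
    (hP : P ∈ W.formalFiltration N) : f P ∈ W'.formalFiltration M := by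
  refine ⟨(hf P (W.formalFiltration_antitone hN₀ hP)).1, ?_⟩
  rw [norm_formalParameter_map_eq_of_linearTerm f hf hk0 hN₀ hC hP, hM]
  exact mul_le_mul_of_nonneg_left hP.2 (norm_nonneg k)

/-- **`f(E⁽ᴺ⁾) = E'⁽ᴹ⁾`** for `p⁻ᴹ = ‖k‖ p⁻ᴺ`, `M ≥ 2`, `N ≥ max(N₀, 2)`, `C p⁻ᴺ < ‖k‖`: the
image of the formal filtration under a homomorphism with linear term `k`.  `⊆` is the norm
identity; for `⊇`, given `Q ∈ E'⁽ᴹ⁾` the element `L'(Q)/k` has norm `≤ p⁻ᴺ`, so it is `L(P)`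
for some `P ∈ E⁽ᴺ⁾` (`L : E⁽ᴺ⁾ → pᴺℤ_p` is onto, Silverman AEC VII.6.3 as proved in
`WeierstrassCurve.exists_mem_padicLimitLog_eq`), and then `L'(f P) = L'(Q)` forces `f P = Q`
(`L'` is injective on `E'⁽ᴹ⁾`).  This is the elementary form of Milne's
"`μ_v(U, ω_A) = μ_v(fU, ω_B)` for any `U ⊆ A(K_v)` mapped injectively into `B(K_v)`"
(ADT I.7, p. 98) for `U = E⁽ᴺ⁾(ℚ_p)`. [cite: MilneADT2006, Ch. I §7, proof of Thm. 7.3, p. 98] -/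
theorem map_formalFiltration_eq_of_linearTerm
    (hf : ∀ P ∈ W.formalFiltration N₀, W'.IsInReductionKernel (f P) ∧
      ‖W'.formalParameter (f P) - k * W.formalParameter P‖ ≤ C * ‖W.formalParameter P‖ ^ 2)
    (hk0 : k ≠ 0) (hN₀ : N₀ ≤ N) (hN2 : 2 ≤ N) (hC : C * ((p : ℝ)⁻¹) ^ N < ‖k‖) {M : ℕ}
    (hM : ((p : ℝ)⁻¹) ^ M = ‖k‖ * ((p : ℝ)⁻¹) ^ N) (hM2 : 2 ≤ M) :
    (W.formalFiltration N).map f = W'.formalFiltration M := by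
  have hpR : (0 : ℝ) < p := by exact_mod_cast (Fact.out : p.Prime).pos
  have hp0 : 0 < (p : ℝ)⁻¹ := inv_pos.mpr hpR
  have hp1 : (p : ℝ)⁻¹ < 1 := inv_lt_one_of_one_lt₀ (by exact_mod_cast (Fact.out : p.Prime).one_lt)
  -- `‖k‖ p⁻ᴺ = p⁻ᴹ ≤ p⁻² < p⁻¹`
  have hk : ‖k‖ * ((p : ℝ)⁻¹) ^ N < (p : ℝ)⁻¹ := by
    rw [← hM]
    calc ((p : ℝ)⁻¹) ^ M ≤ ((p : ℝ)⁻¹) ^ 2 := pow_le_pow_of_le_one hp0.le hp1.le hM2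
      _ < (p : ℝ)⁻¹ := by rw [pow_two]; exact mul_lt_of_lt_one_right hp0 hp1
  ext Q
  constructor
  · rintro ⟨P, hP, rfl⟩
    exact map_mem_formalFiltration_of_linearTerm f hf hk0 hN₀ hC hM hP
  · intro hQ
    -- `t = L'(Q)/k` has norm `≤ p⁻ᴺ`
    have hkpos : 0 < ‖k‖ := norm_pos_iff.mpr hk0
    have ht : ‖W'.padicLimitLog Q / k‖ ≤ ((p : ℝ)⁻¹) ^ N := by
      rw [norm_div, div_le_iff₀ hkpos, W'.norm_padicLimitLog_of_mem hM2 hQ, mul_comm, ← hM]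
      exact hQ.2
    obtain ⟨P, hP, hLP⟩ := W.exists_mem_padicLimitLog_eq hN2 ht
    refine ⟨P, hP, ?_⟩
    have hfP : f P ∈ W'.formalFiltration M :=
      map_mem_formalFiltration_of_linearTerm f hf hk0 hN₀ hC hM hP
    have hL : W'.padicLimitLog (f P) = W'.padicLimitLog Q := by
      rw [padicLimitLog_map_eq_mul_of_linearTerm f hf hk0 hN₀ hN2 hC hk hP, hLP,
        mul_div_cancel₀ _ hk0]
    have h0 : W'.padicLimitLog (f P - Q) = 0 := by
      rw [W'.padicLimitLog_sub_of_mem hM2 hfP hQ, hL, sub_self]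
    exact sub_eq_zero.mp (W'.eq_zero_of_padicLimitLog_eq_zero hM2 (sub_mem hfP hQ) h0)

/-- **`ker f ∩ E⁽ᴺ⁾ = 0`** under the hypotheses of `padicLimitLog_map_eq_mul_of_linearTerm`:
if `f P = O` then `k L(P) = L'(O) = 0`, so `L(P) = 0` and `P = O` (`L` is injective on `E⁽ᴺ⁾`,
`N ≥ 2`). In particular `f` is injective on `E⁽ᴺ⁾ ≅ ℤ_p`. [Milne ADT I.7, p. 98 ("any subset
`U` of `A(K_v)` that is mapped injectively into `B(K_v)`")] [folklore] -/
theorem ker_inf_formalFiltration_eq_bot_of_linearTerm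
    (hf : ∀ P ∈ W.formalFiltration N₀, W'.IsInReductionKernel (f P) ∧
      ‖W'.formalParameter (f P) - k * W.formalParameter P‖ ≤ C * ‖W.formalParameter P‖ ^ 2)
    (hk0 : k ≠ 0) (hN₀ : N₀ ≤ N) (hN2 : 2 ≤ N) (hC : C * ((p : ℝ)⁻¹) ^ N < ‖k‖)
    (hk : ‖k‖ * ((p : ℝ)⁻¹) ^ N < (p : ℝ)⁻¹) :
    f.ker ⊓ W.formalFiltration N = ⊥ := by
  rw [eq_bot_iff]
  rintro P ⟨hPker, hP⟩
  rw [AddSubgroup.mem_bot]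
  have h := padicLimitLog_map_eq_mul_of_linearTerm f hf hk0 hN₀ hN2 hC hk hP
  rw [show f P = 0 from hPker, W'.padicLimitLog_zero, eq_comm, mul_eq_zero] at h
  exact W.eq_zero_of_padicLimitLog_eq_zero hN2 hP (h.resolve_left hk0)

/-- **Packaged form.** If `f : E(ℚ_p) → E'(ℚ_p)` is additive with
`‖z'(f P) - k z(P)‖ ≤ C ‖z(P)‖²` on some `E⁽ᴺ⁰⁾` and `k ≠ 0`, then for all `N ≫ 0` there is
`M ≥ 2` with `p⁻ᴹ = ‖k‖ p⁻ᴺ` (namely `M = N + v_p(k)`) such that `f(E⁽ᴺ⁾) = E'⁽ᴹ⁾` and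
`ker f ∩ E⁽ᴺ⁾ = 0`.  With `[E(ℚ_p) : E⁽ⁿ⁾] = c_p · #Ẽ_ns(𝔽_p) · pⁿ⁻¹` this yields
`#ker f · c'_p #Ẽ'_ns · ‖k‖_p⁻¹ = #coker f · c_p #Ẽ_ns`, Milne's
`z(f(ℚ_p)) = μ_p(E, f^*ω')/μ_p(E', ω')` (ADT I.7, p. 98). [cite: MilneADT2006, Ch. I §7, proof of Thm. 7.3, p. 98] -/
theorem exists_map_formalFiltration_eq_of_linearTerm
    (hf : ∀ P ∈ W.formalFiltration N₀, W'.IsInReductionKernel (f P) ∧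
      ‖W'.formalParameter (f P) - k * W.formalParameter P‖ ≤ C * ‖W.formalParameter P‖ ^ 2)
    (hk0 : k ≠ 0) :
    ∃ N₁ : ℕ, ∀ N : ℕ, N₁ ≤ N → ∃ M : ℕ, 2 ≤ M ∧
      ((p : ℝ)⁻¹) ^ M = ‖k‖ * ((p : ℝ)⁻¹) ^ N ∧
      (W.formalFiltration N).map f = W'.formalFiltration M ∧
      f.ker ⊓ W.formalFiltration N = ⊥ := by
  have hpR : (0 : ℝ) < p := by exact_mod_cast (Fact.out : p.Prime).pos
  have hp0 : 0 < (p : ℝ)⁻¹ := inv_pos.mpr hpR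
  have hp1 : (p : ℝ)⁻¹ < 1 := inv_lt_one_of_one_lt₀ (by exact_mod_cast (Fact.out : p.Prime).one_lt)
  have hkpos : 0 < ‖k‖ := norm_pos_iff.mpr hk0
  -- `‖k‖ = p^{-v}`
  set v : ℤ := k.valuation with hv
  have hknorm : ‖k‖ = (p : ℝ) ^ (-v) := Padic.norm_eq_zpow_neg_valuation hk0
  -- threshold for `C p⁻ᴺ < ‖k‖`
  have hev : ∀ᶠ N : ℕ in atTop, C * ((p : ℝ)⁻¹) ^ N < ‖k‖ := by
    have ht : Tendsto (fun N : ℕ => C * ((p : ℝ)⁻¹) ^ N) atTop (𝓝 (C * 0)) :=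
      (tendsto_pow_atTop_nhds_zero_of_lt_one hp0.le hp1).const_mul C
    rw [mul_zero] at ht
    exact ht.eventually (gt_mem_nhds hkpos)
  obtain ⟨N₂, hN₂⟩ := eventually_atTop.mp hev
  refine ⟨max N₀ (max 2 (max N₂ (2 - v).toNat)), fun N hN => ?_⟩
  have hN₀ : N₀ ≤ N := le_of_max_le_left hN
  have hN2 : 2 ≤ N := le_of_max_le_left (le_of_max_le_right hN)
  have hNN₂ : N₂ ≤ N := le_of_max_le_left (le_of_max_le_right (le_of_max_le_right hN))
  have hNv : (2 - v).toNat ≤ N := le_of_max_le_right (le_of_max_le_right (le_of_max_le_right hN))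
  have hC : C * ((p : ℝ)⁻¹) ^ N < ‖k‖ := hN₂ N hNN₂
  have hMv : (2 : ℤ) ≤ (N : ℤ) + v := by
    have := Int.toNat_le.mp hNv
    omega
  refine ⟨((N : ℤ) + v).toNat, ?_, ?_, ?_, ?_⟩
  · have := Int.toNat_le_toNat hMv
    simpa using this
  · have hcast : (((N : ℤ) + v).toNat : ℤ) = (N : ℤ) + v := Int.toNat_of_nonneg (by omega)
    rw [hknorm, ← zpow_natCast, ← zpow_natCast, inv_zpow', inv_zpow', hcast, ← zpow_add₀ hpR.ne']
    congr 1
    ring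
  · refine map_formalFiltration_eq_of_linearTerm f hf hk0 hN₀ hN2 hC ?_ ?_
    · have hcast : (((N : ℤ) + v).toNat : ℤ) = (N : ℤ) + v := Int.toNat_of_nonneg (by omega)
      rw [hknorm, ← zpow_natCast, ← zpow_natCast, inv_zpow', inv_zpow', hcast, ← zpow_add₀ hpR.ne']
      congr 1
      ring
    · have := Int.toNat_le_toNat hMv
      simpa using this
  · refine ker_inf_formalFiltration_eq_bot_of_linearTerm f hf hk0 hN₀ hN2 hC ?_
    -- `‖k‖ p⁻ᴺ = p^{-(N+v)} ≤ p⁻² < p⁻¹`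
    have hcast : (((N : ℤ) + v).toNat : ℤ) = (N : ℤ) + v := Int.toNat_of_nonneg (by omega)
    have hM : ((p : ℝ)⁻¹) ^ ((N : ℤ) + v).toNat = ‖k‖ * ((p : ℝ)⁻¹) ^ N := by
      rw [hknorm, ← zpow_natCast, ← zpow_natCast, inv_zpow', inv_zpow', hcast, ← zpow_add₀ hpR.ne']
      congr 1
      ring
    have hM2 : 2 ≤ ((N : ℤ) + v).toNat := by
      have := Int.toNat_le_toNat hMv
      simpa using this
    rw [← hM]
    calc ((p : ℝ)⁻¹) ^ ((N : ℤ) + v).toNat ≤ ((p : ℝ)⁻¹) ^ 2 :=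
        pow_le_pow_of_le_one hp0.le hp1.le hM2
      _ < (p : ℝ)⁻¹ := by rw [pow_two]; exact mul_lt_of_lt_one_right hp0 hp1

end WeierstrassCurve
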